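import Literature.NumberTheory.LFunctions.Zhang2022.ObjectiveTwinEllFrameLimit

/-!
# Zhang (2022) design-space objective, twin part 10: the `K₀` threshold on the sheet of record
# `t₀ = D^C·𝓛⁵¹⁹` (`C`-regime; `τ₀ = 2C`), uniformly over all regime records

Y. Zhang, *Discrete mean estimates and the Landau–Siegel zero*, arXiv:2211.02515v1 (2022)
[Zhang2022LandauSiegel] — an unrefereed manuscript under adjudication. **This file SEARCHES and TYPES; it
makes no claim about Landau–Siegel zeros, about Theorems 1–2 of the manuscript, or about a repaired (2.32),
until a kernel theorem says so.** LANDAU–SIEGEL programme, cell `landau-siegel`, §A Lean twin; companion of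
`ObjectiveTwinEllFrameLimit` (part 9, the `C = 0` sheet along `regimeRecord A D`).

B-ell's frame of record (RULING-2, 2026-08-26T18:12:09Z) carries `t₀ = T² = D^{2B}`, i.e. the `C`-regime
`Scales.IsEllRegimePC A C` of `EllRegimeStatements` with `C = 2B` («sheet τ₀ = 2C = 4B»; the numerics seats'
τ₀ = 2.04 tables). Here the part-9 threshold is proved on every `C ≥ 0` sheet and UNIFORMLY over regime records
(not only along the explicit witnesses): with

  `phiLimC A C u = ((A+C+1)/A)·ellFormQ (A/(A+C+½)) (−u₀) u₁ (−u₂)`   (`phiLimC A 0 u = phiLim A u`),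

* `eventually_mainTerm_near_phiLimC` — for every `η > 0` there is `D₁` such that EVERY record of the `C`-regime
  with `D ≥ D₁` has `|F_{ℓ(P)}(rescale (L_M/L_R) (expComb (1,2,3) u)) − phiLimC A C u| < η` (continuity of
  `(ℓ,r) ↦ r⁻¹·ellFormQ(ℓr)` at the limit regime point + `Scales.eventually_ellP_shrink_nearC`);
* `dict_le_neg_phiLimC_of_hnegK0C` — the closing hypothesis `hneg` of `theorem1_of_ellDictK0C` forces
  `(G₀ + λG₁)/A + K/A² ≤ −phiLimC A C u` for every `|λ| ≤ Λ`;
* closed forms on the three `K₀` patterns with `ε_C = (C+½)/(A+C+½) = (1+τ₀)/(2A+1+τ₀)`: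
  `ellFormQ_one_sub_k13/k12/k23` (the pencil at `ℓ = 1 − e` on `k₁−k₃, k₁+k₂, k₂+k₃`: `32πe−16πe²+64πe³`,
  `8π(e−5e²+9e³)`, `8π(e+7e²+5e³)`) and `phiLimC_k13/k12/k23` — so `A·phiLimC → 16π(1+τ₀), 4π(1+τ₀), 4π(1+τ₀)`
  (the lineage-B «sheet τ₀» numbers, cell INBOX 2026-08-26T20:25:34Z / 20:48:44Z).

STATUS OF THE OBJECTS as in parts 6–9. One plumbing definition (`phiLimC`); theorems otherwise.
-/

noncomputable section

open Real Complex ComplexConjugate MeasureTheory Set Filter Topology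

namespace Literature.NumberTheory.LFunctions.Zhang2022

namespace EllRegime

open EllScales

/-- **The limit main term on the sheet `t₀ = D^C·𝓛⁵¹⁹`**: `((A+C+1)/A)·ellFormQ (A/(A+C+½)) (−u₀) u₁ (−u₂)` —
`r*⁻¹·H(ℓ*r*)(v)` at the `C`-regime limit point `ℓ* = (A+C+1)/(A+C+½)`, `r* = A/(A+C+1)`.
[cite: Zhang2022LandauSiegel, §2 (2.8), (2.10), (2.13), (2.23)–(2.25), (2.30)] -/
def phiLimC (A C : ℝ) (u : Fin 3 → ℂ) : ℝ :=
  (A + C + 1) / A * Objective.ellFormQ (A / (A + C + 1 / 2)) (-u 0) (u 1) (-u 2)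

/-- At `C = 0` the sheet is the printed one: `phiLimC A 0 = phiLim A`. [cite: Zhang2022LandauSiegel, §2 (2.8), (2.10)] -/
theorem phiLimC_zero (A : ℝ) (u : Fin 3 → ℂ) : phiLimC A 0 u = phiLim A u := by
  simp [phiLimC, phiLim]

/-- The function `(ℓ, r) ↦ r⁻¹·ellFormQ (ℓr) v` of the scaling law is continuous at every point with `r ≠ 0`.
[cite: Zhang2022LandauSiegel, §2 (2.10), (2.30)] -/
theorem continuousAt_frameValue (x₁ x₂ x₃ : ℂ) {p : ℝ × ℝ} (hp : p.2 ≠ 0) :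
    ContinuousAt (fun q : ℝ × ℝ => q.2⁻¹ * Objective.ellFormQ (q.1 * q.2) x₁ x₂ x₃) p := by
  have h1 : ContinuousAt (fun q : ℝ × ℝ => q.2⁻¹) p := (continuous_snd.continuousAt).inv₀ hp
  have h2 : Continuous (fun q : ℝ × ℝ => Objective.ellFormQ (q.1 * q.2) x₁ x₂ x₃) :=
    (continuous_ellFormQ x₁ x₂ x₃).comp (continuous_fst.mul continuous_snd)
  exact h1.mul h2.continuousAt

/-- **The `K₀` main term is uniformly near its sheet limit**: for `Σ u_j = 0`, `A > 0`, `C ≥ 0` and every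
`η > 0` there is `D₁` such that every record of the `C`-regime with `D ≥ D₁` satisfies
`|F_{ℓ(P)}(rescale (L_M/L_R) (expComb (1,2,3) u)) − phiLimC A C u| < η`.
[cite: Zhang2022LandauSiegel, §2 (2.8), (2.10), (2.23)–(2.25), (2.30)] -/
theorem eventually_mainTerm_near_phiLimC {u : Fin 3 → ℂ} (hu : ∑ j, u j = 0) {A C : ℝ} (hA : 0 < A)
    (hC : 0 ≤ C) {η : ℝ} (hη : 0 < η) :
    ∃ D₁ : ℕ, ∀ S : Scales, D₁ ≤ S.D → S.IsEllRegimePC A C →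
      |mainTermFormEll S.ellP (rescale S.shrink (expComb k123 u)) (rescale' S.shrink (expComb' k123 u))
        - phiLimC A C u| < η := by
  -- continuity of the frame value at the limit regime point
  set p : ℝ × ℝ := ((A + C + 1) / (A + C + 1 / 2), A / (A + C + 1)) with hp
  have hp2 : p.2 ≠ 0 := by
    simp only [hp]
    exact div_ne_zero hA.ne' (by linarith)
  have hcont := continuousAt_frameValue (-u 0) (u 1) (-u 2) hp2
  rw [Metric.continuousAt_iff] at hcont
  obtain ⟨δ, hδ, hδ'⟩ := hcont η hη
  obtain ⟨D₀, hD₀⟩ := Scales.eventually_ellP_shrink_nearC hA hC hδ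
  refine ⟨max D₀ 7, fun S hD hS => ?_⟩
  have hD7 : 7 ≤ S.D := le_trans (le_max_right _ _) hD
  have hDD : D₀ ≤ S.D := le_trans (le_max_left _ _) hD
  obtain ⟨hs0, hs1, -, -, -⟩ := hS.frame_bounds hA hC hD7
  obtain ⟨hℓ, hr⟩ := hD₀ S hDD hS
  -- the main term in closed form
  rw [mainTermFormEll_rescale_expComb_k123 hu _ hs0 hs1]
  -- the limit value is the frame value at `p`
  have hval : p.2⁻¹ * Objective.ellFormQ (p.1 * p.2) (-u 0) (u 1) (-u 2) = phiLimC A C u := by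
    simp only [hp, phiLimC]
    have h1 : A + C + 1 ≠ 0 := by linarith
    have h2 : A + C + 1 / 2 ≠ 0 := by linarith
    congr 1
    · rw [inv_div]
    · congr 1
      field_simp
  have hdist : dist (S.ellP, S.shrink) p < δ := by
    rw [Prod.dist_eq, max_lt_iff]
    exact ⟨by simpa [Real.dist_eq, hp] using hℓ, by simpa [Real.dist_eq, hp] using hr⟩
  have key := hδ' hdist
  rw [hval, Real.dist_eq] at key
  simpa using key

/-- **The kernel threshold on every sheet.** For shifts `(1,2,3)`, `Σ u_j = 0`, `A > 0`, `C ≥ 0`: the closing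
hypothesis `hneg` of `theorem1_of_ellDictK0C` forces `(G₀ + λG₁)/A + K/A² ≤ −phiLimC A C u` for every `|λ| ≤ Λ`.
[cite: Zhang2022LandauSiegel, §2 (2.8), (2.10), (2.23)–(2.25), (2.30); §8 (8.23)] -/
theorem dict_le_neg_phiLimC_of_hnegK0C {u : Fin 3 → ℂ} (hu : ∑ j, u j = 0) {A C G₀ G₁ Λ K : ℝ}
    (hA : 0 < A) (hC : 0 ≤ C)
    (hneg : ∃ D₁ : ℕ, ∀ S : Scales, D₁ ≤ S.D → S.IsEllRegimePC A C → ∀ lam : ℝ, |lam| ≤ Λ →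
      mainTermFormEll S.ellP (rescale S.shrink (expComb k123 u)) (rescale' S.shrink (expComb' k123 u))
        + (G₀ + lam * G₁) / A + K / A ^ 2 < 0)
    {lam : ℝ} (hlam : |lam| ≤ Λ) : (G₀ + lam * G₁) / A + K / A ^ 2 ≤ -phiLimC A C u := by
  by_contra hcon
  have hcon' := not_le.mp hcon
  set dict : ℝ := (G₀ + lam * G₁) / A + K / A ^ 2 with hdict
  have hη : 0 < dict + phiLimC A C u := by linarith
  obtain ⟨D₁, hD₁⟩ := hneg
  obtain ⟨D₂, hD₂⟩ := eventually_mainTerm_near_phiLimC hu hA hC hη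
  set D : ℕ := max D₁ D₂ with hDdef
  have hS := isEllRegimePC_regimeRecordC A C D
  have h1 := hD₁ (regimeRecordC A C D) (le_max_left _ _) hS lam hlam
  have h2 := hD₂ (regimeRecordC A C D) (le_max_right _ _) hS
  rw [abs_lt] at h2
  obtain ⟨h2a, -⟩ := h2
  linarith

/-- `phiLimC ≥ 0` (a uniform limit of non-negative main terms, parts 7–8). [cite: Zhang2022LandauSiegel, §2 (2.10), (2.30)] -/
theorem phiLimC_nonneg {u : Fin 3 → ℂ} (hu : ∑ j, u j = 0) {A C : ℝ} (hA : 0 < A) (hC : 0 ≤ C) :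
    0 ≤ phiLimC A C u := by
  by_contra hcon
  have hcon' := not_le.mp hcon
  obtain ⟨D₂, hD₂⟩ := eventually_mainTerm_near_phiLimC hu hA hC (neg_pos.mpr hcon')
  set D : ℕ := max D₂ 7 with hDdef
  have hS := isEllRegimePC_regimeRecordC A C D
  have h2 := hD₂ (regimeRecordC A C D) (le_max_left _ _) hS
  have h0 := mainTerm_frame_nonnegC (onePieceWV_expComb k123 hu) hS hA hC (le_max_right _ _)
  rw [abs_lt] at h2
  obtain ⟨-, h2b⟩ := h2
  linarith

/-! ## Closed forms on the three `K₀` patterns (`ℓ = 1 − e`) -/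

/-- `H(1−e)` on `k₁ − k₃` (`v = (1, 0, −1)`): `32πe − 16πe² + 64πe³`. [cite: Zhang2022LandauSiegel, §2 (2.10), (2.13)] -/
theorem ellFormQ_one_sub_k13 (e : ℝ) :
    Objective.ellFormQ (1 - e) 1 0 (-1) = 32 * π * e - 16 * π * e ^ 2 + 64 * π * e ^ 3 := by
  simp [Objective.ellFormQ]
  ring

/-- `H(1−e)` on `k₁ + k₂` (`v = (1, 1, 0)`): `8π(e − 5e² + 9e³)`. [cite: Zhang2022LandauSiegel, §2 (2.10), (2.13)] -/
theorem ellFormQ_one_sub_k12 (e : ℝ) :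
    Objective.ellFormQ (1 - e) 1 1 0 = 8 * π * (e - 5 * e ^ 2 + 9 * e ^ 3) := by
  simp [Objective.ellFormQ]
  ring

/-- `H(1−e)` on `k₂ + k₃` (`v = (0, 1, 1)`): `8π(e + 7e² + 5e³)`. [cite: Zhang2022LandauSiegel, §2 (2.10), (2.13)] -/
theorem ellFormQ_one_sub_k23 (e : ℝ) :
    Objective.ellFormQ (1 - e) 0 1 1 = 8 * π * (e + 7 * e ^ 2 + 5 * e ^ 3) := by
  simp [Objective.ellFormQ]
  ring

/-- The sheet's effective deviation: `A/(A+C+½) = 1 − ε_C`, `ε_C = (C+½)/(A+C+½)` (`= (1+τ₀)/(2A+1+τ₀)`, `τ₀ = 2C`).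
[cite: Zhang2022LandauSiegel, §2 (2.8), (2.10)] -/
theorem sheet_ratio_eq {A C : ℝ} (h : A + C + 1 / 2 ≠ 0) :
    A / (A + C + 1 / 2) = 1 - (C + 1 / 2) / (A + C + 1 / 2) := by
  rw [eq_sub_iff_add_eq, ← add_div, show A + (C + 1 / 2) = A + C + 1 / 2 by ring, div_self h]

/-- «K₀-POS-001» on the sheet `C`: `phiLimC A C (−1,0,1) = ((A+C+1)/A)(32πε − 16πε² + 64πε³)`, `ε = (C+½)/(A+C+½)`.
[cite: Zhang2022LandauSiegel, §2 (2.8), (2.10), (2.13), (2.23)–(2.25), (2.30)] -/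
theorem phiLimC_k13 {A C : ℝ} (hA : 0 < A) (hC : 0 ≤ C) :
    phiLimC A C ![-1, 0, 1] = (A + C + 1) / A *
      (32 * π * ((C + 1 / 2) / (A + C + 1 / 2)) - 16 * π * ((C + 1 / 2) / (A + C + 1 / 2)) ^ 2
        + 64 * π * ((C + 1 / 2) / (A + C + 1 / 2)) ^ 3) := by
  have h : A + C + 1 / 2 ≠ 0 := by linarith
  unfold phiLimC
  congr 1
  rw [sheet_ratio_eq h]
  simpa using ellFormQ_one_sub_k13 ((C + 1 / 2) / (A + C + 1 / 2))

/-- «K₀-POS-002» on the sheet `C`: `((A+C+1)/A)·8π(ε − 5ε² + 9ε³)`. [cite: Zhang2022LandauSiegel, §2 (2.8), (2.10), (2.13), (2.23)–(2.25), (2.30)] -/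
theorem phiLimC_k12 {A C : ℝ} (hA : 0 < A) (hC : 0 ≤ C) :
    phiLimC A C ![-1, 1, 0] = (A + C + 1) / A *
      (8 * π * ((C + 1 / 2) / (A + C + 1 / 2) - 5 * ((C + 1 / 2) / (A + C + 1 / 2)) ^ 2
        + 9 * ((C + 1 / 2) / (A + C + 1 / 2)) ^ 3)) := by
  have h : A + C + 1 / 2 ≠ 0 := by linarith
  unfold phiLimC
  congr 1
  rw [sheet_ratio_eq h]
  simpa using ellFormQ_one_sub_k12 ((C + 1 / 2) / (A + C + 1 / 2))

/-- «K₀-POS-003» on the sheet `C`: `((A+C+1)/A)·8π(ε + 7ε² + 5ε³)`. [cite: Zhang2022LandauSiegel, §2 (2.8), (2.10), (2.13), (2.23)–(2.25), (2.30)] -/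
theorem phiLimC_k23 {A C : ℝ} (hA : 0 < A) (hC : 0 ≤ C) :
    phiLimC A C ![0, 1, -1] = (A + C + 1) / A *
      (8 * π * ((C + 1 / 2) / (A + C + 1 / 2) + 7 * ((C + 1 / 2) / (A + C + 1 / 2)) ^ 2
        + 5 * ((C + 1 / 2) / (A + C + 1 / 2)) ^ 3)) := by
  have h : A + C + 1 / 2 ≠ 0 := by linarith
  unfold phiLimC
  congr 1
  rw [sheet_ratio_eq h]
  simpa using ellFormQ_one_sub_k23 ((C + 1 / 2) / (A + C + 1 / 2))

end EllRegime

end Literature.NumberTheory.LFunctions.Zhang2022
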